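import Literature.NumberTheory.NumberFields.IntegralBasisCriterion
import HarnessLib

/-!
# Power integral bases, II: `indexDet · 𝓞 K ⊆ ℤ[θ]` and the index from a partial factorisation of the discriminant
# (Marcus, *Number Fields*, Ch. 2, Exercise 27(c),(e))

Sequel of `IntegralBasisCriterion.lean` (the index determinant `indexDet` of an integral power basis
`1, θ, …, θⁿ⁻¹` of a number field `K`, `disc(1, θ, …) = indexDet² · d_K`, and the case `indexDet = ±1`).
The explicit cubic fields of the generic `2`-descent (`CubicField14483.lean`: `disc = -9 · 14483`, index `3`)
need the case of index `> 1`: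

* `indexDet_smul_mem_span_powInt`, `indexDet_mul_mem_adjoin` — Marcus, Ex. 2.27(c) "`|G/H| · G ⊆ H`":
  `indexDet · x` is a `ℤ`-combination of `1, θ, …, θⁿ⁻¹` for every `x ∈ 𝓞 K` (Cramer's rule for the matrix of
  the powers in an integral basis), so `indexDet · 𝓞 K ⊆ ℤ[θ]`;
* `indexDet_dvd_of_discr_eq_sq_mul`, `mul_mem_adjoin_of_discr_eq_sq_mul` — if `disc(1, θ, …) = r² e` with `e`
  squarefree then `indexDet ∣ r` (prime by prime, `2 v_p(indexDet) ≤ 2 v_p(r) + 1`), hence `r · 𝓞 K ⊆ ℤ[θ]`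
  ("`p² ∤ disc ⇒ p ∤ [𝓞_K : ℤ[θ]]`", the usual complement to Ex. 2.27(e)).

Everything is proved; theorems only. [cite: Marcus2018, Ch. 2, Exercise 27]

## References
* [Marcus2018] D. A. Marcus, *Number Fields*, 2nd ed. (2018), Ch. 2, Exercise 27 (c)–(e).
-/

noncomputable section

open scoped NumberField
open Module NumberField Polynomial

namespace Literature.NumberTheory.NumberFields

variable {K : Type*} [Field K] [NumberField K]

/-! ### `indexDet · 𝓞 K ⊆ ℤ[θ]` and the index from a partial factorisation of the discriminant

-/

/-- **`indexDet · x` is a `ℤ`-combination of `1, θ, …, θⁿ⁻¹`** for every `x ∈ 𝓞 K` (Marcus, Ch. 2,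
Exercise 27(c): `|G/H| G ⊆ H`; here by Cramer's rule / the adjugate of the matrix of `1, θ, …, θⁿ⁻¹`
in an integral basis). [cite: Marcus2018, Ch. 2, Exercise 27(c)] -/
theorem indexDet_smul_mem_span_powInt (B : PowerBasis ℚ K) (hint : IsIntegral ℤ B.gen) (x : 𝓞 K) :
    indexDet B hint • x ∈ Submodule.span ℤ (Set.range (powInt B hint)) := by
  classical
  set b := intBasis B with hb
  set v := powInt B hint with hv
  set M : Matrix (Fin B.dim) (Fin B.dim) ℤ := b.toMatrix v with hM
  set c : Fin B.dim → ℤ := ⇑(b.repr x) with hc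
  set y : Fin B.dim → ℤ := M.cramer c with hy
  have hMy : M.mulVec y = M.det • c := by rw [hy, Matrix.mulVec_cramer]
  have hvj : ∀ j, v j = ∑ i, M i j • b i := fun j => by
    conv_lhs => rw [← b.sum_repr (v j)]
    simp only [hM, Basis.toMatrix_apply]
  have hsum : ∑ j, y j • v j = M.det • x := by
    calc ∑ j, y j • v j = ∑ j, y j • ∑ i, M i j • b i := by simp_rw [← hvj]
      _ = ∑ j, ∑ i, (M i j * y j) • b i := by
          refine Finset.sum_congr rfl fun j _ => ?_
          rw [Finset.smul_sum]
          refine Finset.sum_congr rfl fun i _ => ?_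
          rw [smul_smul, mul_comm]
      _ = ∑ i, ∑ j, (M i j * y j) • b i := Finset.sum_comm
      _ = ∑ i, (M.mulVec y) i • b i := by
          refine Finset.sum_congr rfl fun i _ => ?_
          rw [← Finset.sum_smul, Matrix.mulVec, dotProduct]
      _ = ∑ i, (M.det * c i) • b i := by
          refine Finset.sum_congr rfl fun i _ => ?_
          rw [hMy, Pi.smul_apply, smul_eq_mul]
      _ = M.det • ∑ i, c i • b i := by
          rw [Finset.smul_sum]
          refine Finset.sum_congr rfl fun i _ => ?_
          rw [smul_smul]
      _ = M.det • x := by rw [hc, b.sum_repr x]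
  have hdet : M.det = indexDet B hint := by rw [indexDet, Basis.det_apply]
  rw [← hdet, ← hsum]
  exact Submodule.sum_mem _ fun j _ => Submodule.smul_mem _ _ (Submodule.subset_span ⟨j, rfl⟩)

/-- Hence **`indexDet · x ∈ ℤ[θ]`** for every algebraic integer `x` (`indexDet · 𝓞 K ⊆ ℤ[θ]`; the
integer `indexDet` lies in the conductor of `ℤ[θ]`). [cite: Marcus2018, Ch. 2, Exercise 27(c)] -/
theorem indexDet_mul_mem_adjoin (B : PowerBasis ℚ K) (hint : IsIntegral ℤ B.gen) (x : 𝓞 K) :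
    ((indexDet B hint : ℤ) : K) * (x : K) ∈ Algebra.adjoin ℤ ({B.gen} : Set K) := by
  have hx := indexDet_smul_mem_span_powInt B hint x
  let φ : 𝓞 K →ₗ[ℤ] K := (algebraMap (𝓞 K) K).toIntAlgHom.toLinearMap
  have hle : Submodule.span ℤ (Set.range (powInt B hint)) ≤
      (Subalgebra.toSubmodule (Algebra.adjoin ℤ ({B.gen} : Set K))).comap φ := by
    refine Submodule.span_le.mpr ?_
    rintro _ ⟨j, rfl⟩
    change ((powInt B hint j : 𝓞 K) : K) ∈ Algebra.adjoin ℤ ({B.gen} : Set K)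
    rw [coe_powInt, B.coe_basis]
    exact Subalgebra.pow_mem _ (Algebra.self_mem_adjoin_singleton ℤ B.gen) _
  have h := hle hx
  change ((indexDet B hint • x : 𝓞 K) : K) ∈ Algebra.adjoin ℤ ({B.gen} : Set K) at h
  rwa [zsmul_eq_mul, RingOfIntegers.coe_eq_algebraMap, map_mul, map_intCast] at h

/-- `a² ∣ b² e` with `e` squarefree forces `a ∣ b` (compare prime exponents: `2 v(a) ≤ 2 v(b) + 1`).
[folklore] -/
private theorem dvd_of_sq_dvd_sq_mul_squarefree {a b e : ℤ} (he : Squarefree e) (h : a ^ 2 ∣ b ^ 2 * e) :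
    a ∣ b := by
  rcases eq_or_ne a 0 with rfl | ha
  · rw [zero_pow two_ne_zero, zero_dvd_iff, mul_eq_zero] at h
    rcases h with h | h
    · obtain rfl : b = 0 := (pow_eq_zero_iff two_ne_zero).mp h
      exact dvd_refl 0
    · exact absurd h he.ne_zero
  obtain ⟨g, a', b', hg, hco, rfl, rfl⟩ := Int.exists_gcd_one' (Int.gcd_pos_of_ne_zero_left b ha)
  have hg0 : (g : ℤ) ≠ 0 := by exact_mod_cast hg.ne'
  have h' : a' ^ 2 ∣ b' ^ 2 * e := by
    have : (a' * g) ^ 2 = a' ^ 2 * g ^ 2 := by ring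
    rw [this, show (b' * g) ^ 2 * e = (b' ^ 2 * e) * g ^ 2 by ring] at h
    exact (mul_dvd_mul_iff_right (pow_ne_zero 2 hg0)).mp h
  have hcop : IsCoprime (a' ^ 2) (b' ^ 2) := (Int.isCoprime_iff_gcd_eq_one.mpr hco).pow
  have h'' : a' ^ 2 ∣ e := hcop.dvd_of_dvd_mul_left h'
  have hu : IsUnit a' := he a' (by rw [← pow_two]; exact h'')
  obtain ⟨u, rfl⟩ := hu
  exact mul_dvd_mul (Units.coe_dvd (a := b')) (dvd_refl _)

/-- **`p² ∤ disc ⇒ p ∤ index`, integrally:** if `disc(1, θ, …, θⁿ⁻¹) = r² e` with `e` squarefree then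
`indexDet ∣ r` (from `disc = indexDet² · d_K`). For a squarefree discriminant (`r = 1`) this is
Marcus, Ex. 2.27(e) again; for `disc = 9 · e` it bounds the index by `3`. [cite: Marcus2018, Ch. 2, Exercise 27(c),(e)] -/
theorem indexDet_dvd_of_discr_eq_sq_mul (B : PowerBasis ℚ K) (hint : IsIntegral ℤ B.gen) (r e : ℤ)
    (hd : Algebra.discr ℚ ⇑B.basis = ((r ^ 2 * e : ℤ) : ℚ)) (he : Squarefree e) :
    indexDet B hint ∣ r := by
  have key := discr_powerBasis_eq_indexDet_sq_mul_discr B hint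
  rw [hd] at key
  have hZ : r ^ 2 * e = indexDet B hint ^ 2 * NumberField.discr K := by exact_mod_cast key
  exact dvd_of_sq_dvd_sq_mul_squarefree he ⟨NumberField.discr K, hZ⟩

/-- In the same situation **`r · x ∈ ℤ[θ]` for every algebraic integer `x`** (`r · 𝓞 K ⊆ ℤ[θ]`).
[cite: Marcus2018, Ch. 2, Exercise 27(c),(e)] -/
theorem mul_mem_adjoin_of_discr_eq_sq_mul (B : PowerBasis ℚ K) (hint : IsIntegral ℤ B.gen) (r e : ℤ)
    (hd : Algebra.discr ℚ ⇑B.basis = ((r ^ 2 * e : ℤ) : ℚ)) (he : Squarefree e) (x : 𝓞 K) :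
    ((r : ℤ) : K) * (x : K) ∈ Algebra.adjoin ℤ ({B.gen} : Set K) := by
  obtain ⟨k, hk⟩ := indexDet_dvd_of_discr_eq_sq_mul B hint r e hd he
  rw [hk, Int.cast_mul, mul_comm ((indexDet B hint : ℤ) : K), mul_assoc]
  exact Subalgebra.mul_mem _ (intCast_mem _ k) (indexDet_mul_mem_adjoin B hint x)

end Literature.NumberTheory.NumberFields

end
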